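/-
Copyright (c) 2026 the pub-hodgecm-mathlib formalisation cell (harness21).  Prover seat hodgecm-mathlib-B-p08 (g41): unit U2G_Census (tier-1 assembler), tier-2 spine file 4:
the three PROFILE PIECES of ★ №3 are `K`-supported, `Ad K`-invariant, left-level-invariant, hence `IsLocSmooth` (= U4-a's `PiecePropsWild` clauses for `j = 1, 2, 3`); 2026-09-03.
-/
import Summits.HodgeConjecture.HodgeConjecture.Theorems.F0P3cDyRamProfileLevelClass           -- ★ p854732 (B-p08 (g41)): level-class + `Ad` stability of the profiles; brings ★ p854719, ★ p854672, ★ №3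
import Summits.HodgeConjecture.HodgeConjecture.Theorems.F0P3cDyRamAnchorCountDictionaryZero   -- ★ p854635: brings ★ `placeForm_antidiagThree_eq_over`, `valued_galAdicCompletionMap`
import Literature.NumberTheory.Automorphic.UnitaryLevelTwoLiftPieces                           -- ★ `coe_localNonsplitEquiv_mul`, `coe_coe_localNonsplitEquiv_conj'`, `mem_cmLocalIntegralLevel_of_level`,
                                                                                              -- `isLocSmooth_of_level_invariant_of_support_subset`; brings ★ `mem_cmLocalIntegralLevel_iff_isIntMatrix`
import HarnessLib

/-!
# Crux `H413`, line LH4 «(D-RAM) FOUR-FRAME» road — unit U2G, TIER-2 SPINE 4: the profile pieces `f_{T+}, f_{T−}, f_reg` (★ №3) are `K`-SUPPORTED, `Ad K`-INVARIANT,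
# LEFT-LEVEL-INVARIANT and `IsLocSmooth` on `G_v = U(Φ₃)(L⁺_v)`

Cell `hodgecm-mathlib` (D-0151), FLOOR 0, crux item H413 = `stmt-HodgeConjecture-24833`, route of record `HCCMUnconditional`; squad F0∕P3c∕LH4 (req618); tier-1 units U2G_Census
(assembler B-p08 (g41): the `Continuous f` ∕ `Ad K` inputs of ★ `classOrbitalIntegral_eq_sum_fixedBy_of_support_subset_of_conj_invariant` for the dictionaries
`stub_U2G_dict_transvPlus ∕ transvMinus ∕ reg`) and U4_Rows (dealer LH4-plan (g10) WORD #16: `stub_U4_pieceProps_transvPlus ∕ transvMinus ∕ reg` = the `PiecePropsWild mstarFn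
gselStar` conjuncts of these pieces — clauses smooth ∕ support ∕ `Ad K` here; the fourth clause, left-invariance at the SHARP level `M(w) = mstarFn`, is the `n = mstarFn` case of
§2 under `2 ≤ mstarFn` (true at every wild place, `d ≥ 2 ⇒ m* ≥ 3`), stated separately).  THEOREMS ONLY (no `def`, no instance, no notation, no `sorry`); lane `--supports
stmt-HodgeConjecture-24833 --as helper` (count-neutral).

THE MATHEMATICS ([Kottwitz1986BaseChangeUnits, §1, §3]; [Rogawski1990, §1.6, §4.9]; [BernsteinZelevinsky1976, §1.1]).  `K = cmLocalIntegralLevel`, `ι = localNonsplitEquiv` (`G_v ≃* U(σ_w, Φ₃)(L_w)`),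
`wMatrix u = ι(u)` as a matrix.  A PROFILE PIECE is `f = 1_{K ∩ {u | prof (ι u − 1)}}` for a matrix predicate `prof`.  §1 GENERIC: if `prof` is `Ad (GL₃(𝒪) ∩ U)`-stable then `f(kxk⁻¹) = f x`
for `k ∈ K` (`ι(kxk⁻¹) − 1 = ι k (ι x − 1) (ι k)⁻¹`, ★ `coe_coe_localNonsplitEquiv_conj'`; `ι k ∈ GL₃(𝒪_w)` fixes `𝒪³`); if `prof` is a LEVEL-`n` CLASS FUNCTION on integral matrices
(`prof (X + D) ↔ prof X` for `X` integral, `D ∈ ϖⁿM₃(𝒪)`) then `f(Ux) = f x` whenever `ι U ≡ 1 (ϖⁿ)`, `n ≥ 1` (`U ∈ K` by ★ `mem_cmLocalIntegralLevel_of_level`; for `x ∈ K`: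
`ι(Ux) − 1 = (ι x − 1) + (ι U − 1)·ι x`; for `x ∉ K` both sides vanish); hence `IsLocSmooth f ∧ tsupport f ⊆ K` (★ `isLocSmooth_of_level_invariant_of_support_subset`).
§2 THE THREE PIECES at `n := mstarFn L v w + 2` (any `n ≥ max(m*, ℓ₀ + 1)` works; `ℓ₀ = d % 2 ≤ 1`): the class-function and `Ad` inputs are ★ p854732.
HONEST LABEL.  Count-neutral; the verdict of record for (D-RAM) stays PRINT [LanglandsShelstad1989 Thm. p. 484 ∕ Rogawski1990 Prop. 4.9.1 (a)] ∕ XL; `HC_CM` is proved only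
modulo the 7 printed citations (2 remaining: hLiu418 = `stmt-HodgeConjecture-24832`, h413 = `stmt-HodgeConjecture-24833`) until rung 0 closes.

## References
* [Kottwitz1986BaseChangeUnits] R. E. Kottwitz, *Base change for unit elements of Hecke algebras*, Compositio Math. 60 (1986), §1 pp. 240–241, §3.
* [Rogawski1990] J. D. Rogawski, *Automorphic Representations of Unitary Groups in Three Variables*, Ann. of Math. Stud. 123 (1990), §1.6 p. 6, §4.9 pp. 54–55.
* [BernsteinZelevinsky1976] I. N. Bernstein, A. V. Zelevinsky, Russian Math. Surveys 31 (1976), §1.1.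
-/

noncomputable section

namespace Summit.HodgeConjecture.HodgeConjecture.Cruxes.H413.F0P3cDyRamProfilePiecesProps

open MeasureTheory Measure NumberField IsDedekindDomain Topology Filter
open Literature.NumberTheory.Automorphic Literature.NumberTheory.Automorphic.UnitaryGroup Literature.NumberTheory.Automorphic.IntegralReduction
open Literature.NumberTheory.Automorphic.UnitaryLatticeTree Literature.NumberTheory.Automorphic.HermitianLattice
open Literature.NumberTheory.Rogawski1990 Literature.NumberTheory.GaloisRepresentations
open Literature.NumberTheory.Automorphic.UnitaryThreeFourFrame
open Summit.HodgeConjecture.HodgeConjecture.Cruxes.H413.F0P3cDyRamFourFramePieces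
open Summit.HodgeConjecture.HodgeConjecture.Cruxes.H413.F0P3cDyRamFourFrameCensusDefs
open Summit.HodgeConjecture.HodgeConjecture.Cruxes.H413.F0P3cDyRamProfileLabelTransport
open Summit.HodgeConjecture.HodgeConjecture.Cruxes.H413.F0P3cDyRamProfileLevelClass
open scoped Matrix MatrixGroups Classical ValuativeRel WithZero

variable (L : Type) [Field L] [NumberField L] [IsCMField L] {v : HeightOneSpectrum (𝓞 ↥(maximalRealSubfield L))}
  (w : UnitaryGroup.PlacesOver L v) (hw : IsCMField.complexConj L • w.1 = w.1)

/-! ## §1  Generic: a profile piece `1_{K ∩ {prof (ι u − 1)}}` -/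

include hw in
/-- `ι k` fixes the root `𝒪_w³` for `k ∈ K` (★ `mem_localIntegralLevel_iff_of_smul_eq` + ★ `mapGL_stdLattice_eq_iff_mem_glInt`). [cite: Kottwitz1986BaseChangeUnits, §1 pp. 240–241] -/
theorem mapGL_coe_stdLattice_eq_of_mem {k : ((UnitaryGroup.cmDatum L 3 (Matrix.of fun i j : Fin 3 => if i.val + j.val + 1 = 3 then (1 : L) else 0)).Local v)} (hk : k ∈ cmLocalIntegralLevel L 3 (Matrix.of fun i j : Fin 3 => if i.val + j.val + 1 = 3 then (1 : L) else 0) v) :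
    mapGL ((localNonsplitEquiv (IsCMField.complexConj L) (Matrix.of fun i j : Fin 3 => if i.val + j.val + 1 = 3 then (1 : L) else 0) (IsCMField.complexConj_ne_one L) w hw k :
        ↥(unitaryGroupOfForm (galAdicCompletionMap (L := L) (IsCMField.complexConj L) hw) (placeForm (Matrix.of fun i j : Fin 3 => if i.val + j.val + 1 = 3 then (1 : L) else 0) w.1))) : GL (Fin 3) (w.1.adicCompletion L)) (stdLattice (w.1.adicCompletion L) 3) = stdLattice (w.1.adicCompletion L) 3 :=
  (mapGL_stdLattice_eq_iff_mem_glInt _).2 ((mem_localIntegralLevel_iff_of_smul_eq (IsCMField.complexConj L) 3 (Matrix.of fun i j : Fin 3 => if i.val + j.val + 1 = 3 then (1 : L) else 0) (IsCMField.complexConj_ne_one L) w hw k).1 hk)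

include hw in
/-- `ι u ∈ U(σ_w, Φ₃)` in the `StdForm` spelling (★ `placeForm_antidiagThree_eq_over`). [cite: Rogawski1990, §4.9 Prop. 4.9.1 (b) p. 55] -/
theorem coe_mem_unitaryGroupOfForm_over (u : ((UnitaryGroup.cmDatum L 3 (Matrix.of fun i j : Fin 3 => if i.val + j.val + 1 = 3 then (1 : L) else 0)).Local v)) :
    ((localNonsplitEquiv (IsCMField.complexConj L) (Matrix.of fun i j : Fin 3 => if i.val + j.val + 1 = 3 then (1 : L) else 0) (IsCMField.complexConj_ne_one L) w hw u :
        ↥(unitaryGroupOfForm (galAdicCompletionMap (L := L) (IsCMField.complexConj L) hw) (placeForm (Matrix.of fun i j : Fin 3 => if i.val + j.val + 1 = 3 then (1 : L) else 0) w.1))) : GL (Fin 3) (w.1.adicCompletion L)) ∈ unitaryGroupOfForm (galAdicCompletionMap (L := L) (IsCMField.complexConj L) hw) ((StdForm.antidiagonal 3).over (w.1.adicCompletion L)) := by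
  rw [← placeForm_antidiagThree_eq_over L w]
  exact (localNonsplitEquiv (IsCMField.complexConj L) (Matrix.of fun i j : Fin 3 => if i.val + j.val + 1 = 3 then (1 : L) else 0) (IsCMField.complexConj_ne_one L) w hw u).2

include hw in
/-- **`Ad K`-INVARIANCE OF A PROFILE PIECE**: if `prof (g⁻¹Xg) ↔ prof X` for every unitary `g` fixing `𝒪³`, then `1_{K ∩ {prof(ι u − 1)}}(kxk⁻¹) = 1_{…}(x)` for `k ∈ K`.
[cite: Kottwitz1986BaseChangeUnits, §3] [cite: Rogawski1990, §4.9 p. 54] -/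
theorem indicator_profile_conj_eq (prof : Matrix (Fin 3) (Fin 3) (w.1.adicCompletion L) → Prop)
    (hconj : ∀ (g : GL (Fin 3) (w.1.adicCompletion L)), g ∈ unitaryGroupOfForm (galAdicCompletionMap (L := L) (IsCMField.complexConj L) hw) ((StdForm.antidiagonal 3).over (w.1.adicCompletion L)) →
      mapGL g (stdLattice (w.1.adicCompletion L) 3) = stdLattice (w.1.adicCompletion L) 3 →
      ∀ X, prof ((g : Matrix (Fin 3) (Fin 3) (w.1.adicCompletion L))⁻¹ * X * (g : Matrix (Fin 3) (Fin 3) (w.1.adicCompletion L))) ↔ prof X)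
    {k : ((UnitaryGroup.cmDatum L 3 (Matrix.of fun i j : Fin 3 => if i.val + j.val + 1 = 3 then (1 : L) else 0)).Local v)} (hk : k ∈ cmLocalIntegralLevel L 3 (Matrix.of fun i j : Fin 3 => if i.val + j.val + 1 = 3 then (1 : L) else 0) v) (x : ((UnitaryGroup.cmDatum L 3 (Matrix.of fun i j : Fin 3 => if i.val + j.val + 1 = 3 then (1 : L) else 0)).Local v)) :
    Set.indicator {u : ((UnitaryGroup.cmDatum L 3 (Matrix.of fun i j : Fin 3 => if i.val + j.val + 1 = 3 then (1 : L) else 0)).Local v) | u ∈ cmLocalIntegralLevel L 3 (Matrix.of fun i j : Fin 3 => if i.val + j.val + 1 = 3 then (1 : L) else 0) v ∧ prof ((((localNonsplitEquiv (IsCMField.complexConj L) (Matrix.of fun i j : Fin 3 => if i.val + j.val + 1 = 3 then (1 : L) else 0) (IsCMField.complexConj_ne_one L) w hw u :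
        ↥(unitaryGroupOfForm (galAdicCompletionMap (L := L) (IsCMField.complexConj L) hw) (placeForm (Matrix.of fun i j : Fin 3 => if i.val + j.val + 1 = 3 then (1 : L) else 0) w.1))) : GL (Fin 3) (w.1.adicCompletion L)) : Matrix (Fin 3) (Fin 3) (w.1.adicCompletion L)) - 1)}
        (fun _ => (1 : ℂ)) (k * x * k⁻¹) =
      Set.indicator {u : ((UnitaryGroup.cmDatum L 3 (Matrix.of fun i j : Fin 3 => if i.val + j.val + 1 = 3 then (1 : L) else 0)).Local v) | u ∈ cmLocalIntegralLevel L 3 (Matrix.of fun i j : Fin 3 => if i.val + j.val + 1 = 3 then (1 : L) else 0) v ∧ prof ((((localNonsplitEquiv (IsCMField.complexConj L) (Matrix.of fun i j : Fin 3 => if i.val + j.val + 1 = 3 then (1 : L) else 0) (IsCMField.complexConj_ne_one L) w hw u :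
        ↥(unitaryGroupOfForm (galAdicCompletionMap (L := L) (IsCMField.complexConj L) hw) (placeForm (Matrix.of fun i j : Fin 3 => if i.val + j.val + 1 = 3 then (1 : L) else 0) w.1))) : GL (Fin 3) (w.1.adicCompletion L)) : Matrix (Fin 3) (Fin 3) (w.1.adicCompletion L)) - 1)}
        (fun _ => (1 : ℂ)) x := by
  -- `g := (ι k)⁻¹` is unitary and fixes `𝒪³`; `ι(kxk⁻¹) − 1 = g⁻¹ (ι x − 1) g`
  set A := ((localNonsplitEquiv (IsCMField.complexConj L) (Matrix.of fun i j : Fin 3 => if i.val + j.val + 1 = 3 then (1 : L) else 0) (IsCMField.complexConj_ne_one L) w hw k :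
        ↥(unitaryGroupOfForm (galAdicCompletionMap (L := L) (IsCMField.complexConj L) hw) (placeForm (Matrix.of fun i j : Fin 3 => if i.val + j.val + 1 = 3 then (1 : L) else 0) w.1))) : GL (Fin 3) (w.1.adicCompletion L)) with hA
  have hgU : A⁻¹ ∈ unitaryGroupOfForm (galAdicCompletionMap (L := L) (IsCMField.complexConj L) hw) ((StdForm.antidiagonal 3).over (w.1.adicCompletion L)) := inv_mem (coe_mem_unitaryGroupOfForm_over L w hw k)
  have hgL : mapGL A⁻¹ (stdLattice (w.1.adicCompletion L) 3) = stdLattice (w.1.adicCompletion L) 3 := by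
    have h := mapGL_coe_stdLattice_eq_of_mem L w hw hk
    rw [← hA] at h
    conv_lhs => rw [← h]
    rw [← mapGL_mul, inv_mul_cancel, mapGL_one]
  have hmat : ((((localNonsplitEquiv (IsCMField.complexConj L) (Matrix.of fun i j : Fin 3 => if i.val + j.val + 1 = 3 then (1 : L) else 0) (IsCMField.complexConj_ne_one L) w hw (k * x * k⁻¹) :
        ↥(unitaryGroupOfForm (galAdicCompletionMap (L := L) (IsCMField.complexConj L) hw) (placeForm (Matrix.of fun i j : Fin 3 => if i.val + j.val + 1 = 3 then (1 : L) else 0) w.1))) : GL (Fin 3) (w.1.adicCompletion L)) : Matrix (Fin 3) (Fin 3) (w.1.adicCompletion L)) - 1) =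
      ((A⁻¹ : GL (Fin 3) (w.1.adicCompletion L)) : Matrix (Fin 3) (Fin 3) (w.1.adicCompletion L))⁻¹ *
        (((((localNonsplitEquiv (IsCMField.complexConj L) (Matrix.of fun i j : Fin 3 => if i.val + j.val + 1 = 3 then (1 : L) else 0) (IsCMField.complexConj_ne_one L) w hw x :
        ↥(unitaryGroupOfForm (galAdicCompletionMap (L := L) (IsCMField.complexConj L) hw) (placeForm (Matrix.of fun i j : Fin 3 => if i.val + j.val + 1 = 3 then (1 : L) else 0) w.1))) : GL (Fin 3) (w.1.adicCompletion L)) : Matrix (Fin 3) (Fin 3) (w.1.adicCompletion L)) - 1)) * ((A⁻¹ : GL (Fin 3) (w.1.adicCompletion L)) : Matrix (Fin 3) (Fin 3) (w.1.adicCompletion L)) := by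
    rw [coe_coe_localNonsplitEquiv_conj' L 3 (Matrix.of fun i j : Fin 3 => if i.val + j.val + 1 = 3 then (1 : L) else 0) (IsCMField.complexConj_ne_one L) w hw k x, ← hA]
    simp only [Matrix.coe_units_inv]
    rw [Matrix.nonsing_inv_nonsing_inv _ (Matrix.isUnits_det_units A), Matrix.mul_sub, Matrix.sub_mul, Matrix.mul_one,
      Matrix.mul_nonsing_inv _ (Matrix.isUnits_det_units A)]
  have hmem : k * x * k⁻¹ ∈ cmLocalIntegralLevel L 3 (Matrix.of fun i j : Fin 3 => if i.val + j.val + 1 = 3 then (1 : L) else 0) v ↔ x ∈ cmLocalIntegralLevel L 3 (Matrix.of fun i j : Fin 3 => if i.val + j.val + 1 = 3 then (1 : L) else 0) v := by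
    constructor
    · intro h
      have h' := Subgroup.mul_mem _ (Subgroup.mul_mem _ (inv_mem hk) h) hk
      rwa [← mul_assoc, ← mul_assoc, inv_mul_cancel, one_mul, inv_mul_cancel_right] at h'
    · intro h
      exact Subgroup.mul_mem _ (Subgroup.mul_mem _ hk h) (inv_mem hk)
  have hiff : (k * x * k⁻¹ ∈ cmLocalIntegralLevel L 3 (Matrix.of fun i j : Fin 3 => if i.val + j.val + 1 = 3 then (1 : L) else 0) v ∧ prof ((((localNonsplitEquiv (IsCMField.complexConj L) (Matrix.of fun i j : Fin 3 => if i.val + j.val + 1 = 3 then (1 : L) else 0) (IsCMField.complexConj_ne_one L) w hw (k * x * k⁻¹) :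
        ↥(unitaryGroupOfForm (galAdicCompletionMap (L := L) (IsCMField.complexConj L) hw) (placeForm (Matrix.of fun i j : Fin 3 => if i.val + j.val + 1 = 3 then (1 : L) else 0) w.1))) : GL (Fin 3) (w.1.adicCompletion L)) : Matrix (Fin 3) (Fin 3) (w.1.adicCompletion L)) - 1)) ↔
      (x ∈ cmLocalIntegralLevel L 3 (Matrix.of fun i j : Fin 3 => if i.val + j.val + 1 = 3 then (1 : L) else 0) v ∧ prof ((((localNonsplitEquiv (IsCMField.complexConj L) (Matrix.of fun i j : Fin 3 => if i.val + j.val + 1 = 3 then (1 : L) else 0) (IsCMField.complexConj_ne_one L) w hw x :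
        ↥(unitaryGroupOfForm (galAdicCompletionMap (L := L) (IsCMField.complexConj L) hw) (placeForm (Matrix.of fun i j : Fin 3 => if i.val + j.val + 1 = 3 then (1 : L) else 0) w.1))) : GL (Fin 3) (w.1.adicCompletion L)) : Matrix (Fin 3) (Fin 3) (w.1.adicCompletion L)) - 1)) := by
    rw [hmem, hmat, hconj _ hgU hgL]
  simp only [Set.indicator_apply, Set.mem_setOf_eq]
  by_cases hx : (x ∈ cmLocalIntegralLevel L 3 (Matrix.of fun i j : Fin 3 => if i.val + j.val + 1 = 3 then (1 : L) else 0) v ∧ prof ((((localNonsplitEquiv (IsCMField.complexConj L) (Matrix.of fun i j : Fin 3 => if i.val + j.val + 1 = 3 then (1 : L) else 0) (IsCMField.complexConj_ne_one L) w hw x :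
        ↥(unitaryGroupOfForm (galAdicCompletionMap (L := L) (IsCMField.complexConj L) hw) (placeForm (Matrix.of fun i j : Fin 3 => if i.val + j.val + 1 = 3 then (1 : L) else 0) w.1))) : GL (Fin 3) (w.1.adicCompletion L)) : Matrix (Fin 3) (Fin 3) (w.1.adicCompletion L)) - 1))
  · rw [if_pos hx, if_pos (hiff.2 hx)]
  · rw [if_neg hx, if_neg (fun h => hx (hiff.1 h))]

include hw in
/-- **LEFT-LEVEL INVARIANCE OF A PROFILE PIECE**: if `prof (X + D) ↔ prof X` for integral `X` and `D ∈ ϖⁿM₃(𝒪)`, then for `ι U ≡ 1 (mod ϖⁿ)` (`n ≥ 1`, `|ϖ| < 1`):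
`1_{K ∩ {prof(ι u − 1)}}(Ux) = 1_{…}(x)` (`ι(Ux) − 1 = (ι x − 1) + (ι U − 1)·ι x`). [cite: Kottwitz1986BaseChangeUnits, §3] [cite: BernsteinZelevinsky1976, §1.1] -/
theorem indicator_profile_level_mul_eq (prof : Matrix (Fin 3) (Fin 3) (w.1.adicCompletion L) → Prop) {ϖ : w.1.adicCompletion L} (hϖ0 : ϖ ≠ 0) (hϖ1 : Valued.v ϖ < 1)
    {n : ℕ} (hn : 1 ≤ n)
    (hclass : ∀ X D : Matrix (Fin 3) (Fin 3) (w.1.adicCompletion L), IsIntMatrix X → InLevel ϖ n D → (prof (X + D) ↔ prof X))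
    (U : ((UnitaryGroup.cmDatum L 3 (Matrix.of fun i j : Fin 3 => if i.val + j.val + 1 = 3 then (1 : L) else 0)).Local v)) (hU : IsIntMatrix ((ϖ ^ n)⁻¹ • (((((localNonsplitEquiv (IsCMField.complexConj L) (Matrix.of fun i j : Fin 3 => if i.val + j.val + 1 = 3 then (1 : L) else 0) (IsCMField.complexConj_ne_one L) w hw U :
        ↥(unitaryGroupOfForm (galAdicCompletionMap (L := L) (IsCMField.complexConj L) hw) (placeForm (Matrix.of fun i j : Fin 3 => if i.val + j.val + 1 = 3 then (1 : L) else 0) w.1))) : GL (Fin 3) (w.1.adicCompletion L)) : Matrix (Fin 3) (Fin 3) (w.1.adicCompletion L))) - 1))) (x : ((UnitaryGroup.cmDatum L 3 (Matrix.of fun i j : Fin 3 => if i.val + j.val + 1 = 3 then (1 : L) else 0)).Local v)) :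
    Set.indicator {u : ((UnitaryGroup.cmDatum L 3 (Matrix.of fun i j : Fin 3 => if i.val + j.val + 1 = 3 then (1 : L) else 0)).Local v) | u ∈ cmLocalIntegralLevel L 3 (Matrix.of fun i j : Fin 3 => if i.val + j.val + 1 = 3 then (1 : L) else 0) v ∧ prof ((((localNonsplitEquiv (IsCMField.complexConj L) (Matrix.of fun i j : Fin 3 => if i.val + j.val + 1 = 3 then (1 : L) else 0) (IsCMField.complexConj_ne_one L) w hw u :
        ↥(unitaryGroupOfForm (galAdicCompletionMap (L := L) (IsCMField.complexConj L) hw) (placeForm (Matrix.of fun i j : Fin 3 => if i.val + j.val + 1 = 3 then (1 : L) else 0) w.1))) : GL (Fin 3) (w.1.adicCompletion L)) : Matrix (Fin 3) (Fin 3) (w.1.adicCompletion L)) - 1)}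
        (fun _ => (1 : ℂ)) (U * x) =
      Set.indicator {u : ((UnitaryGroup.cmDatum L 3 (Matrix.of fun i j : Fin 3 => if i.val + j.val + 1 = 3 then (1 : L) else 0)).Local v) | u ∈ cmLocalIntegralLevel L 3 (Matrix.of fun i j : Fin 3 => if i.val + j.val + 1 = 3 then (1 : L) else 0) v ∧ prof ((((localNonsplitEquiv (IsCMField.complexConj L) (Matrix.of fun i j : Fin 3 => if i.val + j.val + 1 = 3 then (1 : L) else 0) (IsCMField.complexConj_ne_one L) w hw u :
        ↥(unitaryGroupOfForm (galAdicCompletionMap (L := L) (IsCMField.complexConj L) hw) (placeForm (Matrix.of fun i j : Fin 3 => if i.val + j.val + 1 = 3 then (1 : L) else 0) w.1))) : GL (Fin 3) (w.1.adicCompletion L)) : Matrix (Fin 3) (Fin 3) (w.1.adicCompletion L)) - 1)}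
        (fun _ => (1 : ℂ)) x := by
  have hUK : U ∈ cmLocalIntegralLevel L 3 (Matrix.of fun i j : Fin 3 => if i.val + j.val + 1 = 3 then (1 : L) else 0) v :=
    mem_cmLocalIntegralLevel_of_level L 3 (Matrix.of fun i j : Fin 3 => if i.val + j.val + 1 = 3 then (1 : L) else 0) (IsCMField.complexConj_ne_one L) w hw hϖ0 hϖ1 hn U hU
  have hmem : U * x ∈ cmLocalIntegralLevel L 3 (Matrix.of fun i j : Fin 3 => if i.val + j.val + 1 = 3 then (1 : L) else 0) v ↔ x ∈ cmLocalIntegralLevel L 3 (Matrix.of fun i j : Fin 3 => if i.val + j.val + 1 = 3 then (1 : L) else 0) v := by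
    constructor
    · intro h
      have h' := Subgroup.mul_mem _ (inv_mem hUK) h
      rwa [inv_mul_cancel_left] at h'
    · exact fun h => Subgroup.mul_mem _ hUK h
  have hiff : (U * x ∈ cmLocalIntegralLevel L 3 (Matrix.of fun i j : Fin 3 => if i.val + j.val + 1 = 3 then (1 : L) else 0) v ∧ prof ((((localNonsplitEquiv (IsCMField.complexConj L) (Matrix.of fun i j : Fin 3 => if i.val + j.val + 1 = 3 then (1 : L) else 0) (IsCMField.complexConj_ne_one L) w hw (U * x) :
        ↥(unitaryGroupOfForm (galAdicCompletionMap (L := L) (IsCMField.complexConj L) hw) (placeForm (Matrix.of fun i j : Fin 3 => if i.val + j.val + 1 = 3 then (1 : L) else 0) w.1))) : GL (Fin 3) (w.1.adicCompletion L)) : Matrix (Fin 3) (Fin 3) (w.1.adicCompletion L)) - 1)) ↔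
      (x ∈ cmLocalIntegralLevel L 3 (Matrix.of fun i j : Fin 3 => if i.val + j.val + 1 = 3 then (1 : L) else 0) v ∧ prof ((((localNonsplitEquiv (IsCMField.complexConj L) (Matrix.of fun i j : Fin 3 => if i.val + j.val + 1 = 3 then (1 : L) else 0) (IsCMField.complexConj_ne_one L) w hw x :
        ↥(unitaryGroupOfForm (galAdicCompletionMap (L := L) (IsCMField.complexConj L) hw) (placeForm (Matrix.of fun i j : Fin 3 => if i.val + j.val + 1 = 3 then (1 : L) else 0) w.1))) : GL (Fin 3) (w.1.adicCompletion L)) : Matrix (Fin 3) (Fin 3) (w.1.adicCompletion L)) - 1)) := by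
    rw [hmem]
    refine and_congr_right fun hx => ?_
    have hxint : IsIntMatrix ((((localNonsplitEquiv (IsCMField.complexConj L) (Matrix.of fun i j : Fin 3 => if i.val + j.val + 1 = 3 then (1 : L) else 0) (IsCMField.complexConj_ne_one L) w hw x :
        ↥(unitaryGroupOfForm (galAdicCompletionMap (L := L) (IsCMField.complexConj L) hw) (placeForm (Matrix.of fun i j : Fin 3 => if i.val + j.val + 1 = 3 then (1 : L) else 0) w.1))) : GL (Fin 3) (w.1.adicCompletion L)) : Matrix (Fin 3) (Fin 3) (w.1.adicCompletion L))) :=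
      ((mem_cmLocalIntegralLevel_iff_isIntMatrix L 3 (Matrix.of fun i j : Fin 3 => if i.val + j.val + 1 = 3 then (1 : L) else 0) (IsCMField.complexConj_ne_one L) w hw x).1 hx).1
    have hX : IsIntMatrix ((((localNonsplitEquiv (IsCMField.complexConj L) (Matrix.of fun i j : Fin 3 => if i.val + j.val + 1 = 3 then (1 : L) else 0) (IsCMField.complexConj_ne_one L) w hw x :
        ↥(unitaryGroupOfForm (galAdicCompletionMap (L := L) (IsCMField.complexConj L) hw) (placeForm (Matrix.of fun i j : Fin 3 => if i.val + j.val + 1 = 3 then (1 : L) else 0) w.1))) : GL (Fin 3) (w.1.adicCompletion L)) : Matrix (Fin 3) (Fin 3) (w.1.adicCompletion L)) - 1) := isIntMatrix_sub hxint isIntMatrix_one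
    have hD : InLevel ϖ n ((((((localNonsplitEquiv (IsCMField.complexConj L) (Matrix.of fun i j : Fin 3 => if i.val + j.val + 1 = 3 then (1 : L) else 0) (IsCMField.complexConj_ne_one L) w hw U :
        ↥(unitaryGroupOfForm (galAdicCompletionMap (L := L) (IsCMField.complexConj L) hw) (placeForm (Matrix.of fun i j : Fin 3 => if i.val + j.val + 1 = 3 then (1 : L) else 0) w.1))) : GL (Fin 3) (w.1.adicCompletion L)) : Matrix (Fin 3) (Fin 3) (w.1.adicCompletion L))) - 1) * ((((localNonsplitEquiv (IsCMField.complexConj L) (Matrix.of fun i j : Fin 3 => if i.val + j.val + 1 = 3 then (1 : L) else 0) (IsCMField.complexConj_ne_one L) w hw x :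
        ↥(unitaryGroupOfForm (galAdicCompletionMap (L := L) (IsCMField.complexConj L) hw) (placeForm (Matrix.of fun i j : Fin 3 => if i.val + j.val + 1 = 3 then (1 : L) else 0) w.1))) : GL (Fin 3) (w.1.adicCompletion L)) : Matrix (Fin 3) (Fin 3) (w.1.adicCompletion L)))) :=
      inLevel_mul_of_isIntMatrix_right ϖ n ((inLevel_iff_isIntMatrix_smul ϖ n _).2 hU) hxint
    have e : ((((localNonsplitEquiv (IsCMField.complexConj L) (Matrix.of fun i j : Fin 3 => if i.val + j.val + 1 = 3 then (1 : L) else 0) (IsCMField.complexConj_ne_one L) w hw (U * x) :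
        ↥(unitaryGroupOfForm (galAdicCompletionMap (L := L) (IsCMField.complexConj L) hw) (placeForm (Matrix.of fun i j : Fin 3 => if i.val + j.val + 1 = 3 then (1 : L) else 0) w.1))) : GL (Fin 3) (w.1.adicCompletion L)) : Matrix (Fin 3) (Fin 3) (w.1.adicCompletion L)) - 1) =
        (((((localNonsplitEquiv (IsCMField.complexConj L) (Matrix.of fun i j : Fin 3 => if i.val + j.val + 1 = 3 then (1 : L) else 0) (IsCMField.complexConj_ne_one L) w hw x :
        ↥(unitaryGroupOfForm (galAdicCompletionMap (L := L) (IsCMField.complexConj L) hw) (placeForm (Matrix.of fun i j : Fin 3 => if i.val + j.val + 1 = 3 then (1 : L) else 0) w.1))) : GL (Fin 3) (w.1.adicCompletion L)) : Matrix (Fin 3) (Fin 3) (w.1.adicCompletion L)) - 1) +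
          (((((localNonsplitEquiv (IsCMField.complexConj L) (Matrix.of fun i j : Fin 3 => if i.val + j.val + 1 = 3 then (1 : L) else 0) (IsCMField.complexConj_ne_one L) w hw U :
        ↥(unitaryGroupOfForm (galAdicCompletionMap (L := L) (IsCMField.complexConj L) hw) (placeForm (Matrix.of fun i j : Fin 3 => if i.val + j.val + 1 = 3 then (1 : L) else 0) w.1))) : GL (Fin 3) (w.1.adicCompletion L)) : Matrix (Fin 3) (Fin 3) (w.1.adicCompletion L))) - 1) * ((((localNonsplitEquiv (IsCMField.complexConj L) (Matrix.of fun i j : Fin 3 => if i.val + j.val + 1 = 3 then (1 : L) else 0) (IsCMField.complexConj_ne_one L) w hw x :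
        ↥(unitaryGroupOfForm (galAdicCompletionMap (L := L) (IsCMField.complexConj L) hw) (placeForm (Matrix.of fun i j : Fin 3 => if i.val + j.val + 1 = 3 then (1 : L) else 0) w.1))) : GL (Fin 3) (w.1.adicCompletion L)) : Matrix (Fin 3) (Fin 3) (w.1.adicCompletion L)))) := by
      rw [coe_localNonsplitEquiv_mul L 3 (Matrix.of fun i j : Fin 3 => if i.val + j.val + 1 = 3 then (1 : L) else 0) (IsCMField.complexConj_ne_one L) w hw U x, Units.val_mul, Matrix.sub_mul, Matrix.one_mul]
      abel
    rw [e, hclass _ _ hX hD]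
  simp only [Set.indicator_apply, Set.mem_setOf_eq]
  by_cases hx : (x ∈ cmLocalIntegralLevel L 3 (Matrix.of fun i j : Fin 3 => if i.val + j.val + 1 = 3 then (1 : L) else 0) v ∧ prof ((((localNonsplitEquiv (IsCMField.complexConj L) (Matrix.of fun i j : Fin 3 => if i.val + j.val + 1 = 3 then (1 : L) else 0) (IsCMField.complexConj_ne_one L) w hw x :
        ↥(unitaryGroupOfForm (galAdicCompletionMap (L := L) (IsCMField.complexConj L) hw) (placeForm (Matrix.of fun i j : Fin 3 => if i.val + j.val + 1 = 3 then (1 : L) else 0) w.1))) : GL (Fin 3) (w.1.adicCompletion L)) : Matrix (Fin 3) (Fin 3) (w.1.adicCompletion L)) - 1))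
  · rw [if_pos hx, if_pos (hiff.2 hx)]
  · rw [if_neg hx, if_neg (fun h => hx (hiff.1 h))]

include hw in
/-- **A PROFILE PIECE IS `IsLocSmooth` WITH `tsupport ⊆ K`** when its predicate is a level class function (★ `isLocSmooth_of_level_invariant_of_support_subset`).
[cite: BernsteinZelevinsky1976, §1.1] [cite: Rogawski1990, §1.6 p. 6] -/
theorem isLocSmooth_indicator_profile (prof : Matrix (Fin 3) (Fin 3) (w.1.adicCompletion L) → Prop) {ϖ : w.1.adicCompletion L} (hϖ0 : ϖ ≠ 0) (hϖ1 : Valued.v ϖ < 1)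
    {n : ℕ} (hn : 1 ≤ n)
    (hclass : ∀ X D : Matrix (Fin 3) (Fin 3) (w.1.adicCompletion L), IsIntMatrix X → InLevel ϖ n D → (prof (X + D) ↔ prof X)) :
    IsLocSmooth (Set.indicator {u : ((UnitaryGroup.cmDatum L 3 (Matrix.of fun i j : Fin 3 => if i.val + j.val + 1 = 3 then (1 : L) else 0)).Local v) | u ∈ cmLocalIntegralLevel L 3 (Matrix.of fun i j : Fin 3 => if i.val + j.val + 1 = 3 then (1 : L) else 0) v ∧ prof ((((localNonsplitEquiv (IsCMField.complexConj L) (Matrix.of fun i j : Fin 3 => if i.val + j.val + 1 = 3 then (1 : L) else 0) (IsCMField.complexConj_ne_one L) w hw u :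
        ↥(unitaryGroupOfForm (galAdicCompletionMap (L := L) (IsCMField.complexConj L) hw) (placeForm (Matrix.of fun i j : Fin 3 => if i.val + j.val + 1 = 3 then (1 : L) else 0) w.1))) : GL (Fin 3) (w.1.adicCompletion L)) : Matrix (Fin 3) (Fin 3) (w.1.adicCompletion L)) - 1)}
        (fun _ => (1 : ℂ))) ∧
      tsupport (Set.indicator {u : ((UnitaryGroup.cmDatum L 3 (Matrix.of fun i j : Fin 3 => if i.val + j.val + 1 = 3 then (1 : L) else 0)).Local v) | u ∈ cmLocalIntegralLevel L 3 (Matrix.of fun i j : Fin 3 => if i.val + j.val + 1 = 3 then (1 : L) else 0) v ∧ prof ((((localNonsplitEquiv (IsCMField.complexConj L) (Matrix.of fun i j : Fin 3 => if i.val + j.val + 1 = 3 then (1 : L) else 0) (IsCMField.complexConj_ne_one L) w hw u :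
        ↥(unitaryGroupOfForm (galAdicCompletionMap (L := L) (IsCMField.complexConj L) hw) (placeForm (Matrix.of fun i j : Fin 3 => if i.val + j.val + 1 = 3 then (1 : L) else 0) w.1))) : GL (Fin 3) (w.1.adicCompletion L)) : Matrix (Fin 3) (Fin 3) (w.1.adicCompletion L)) - 1)}
        (fun _ => (1 : ℂ))) ⊆ (cmLocalIntegralLevel L 3 (Matrix.of fun i j : Fin 3 => if i.val + j.val + 1 = 3 then (1 : L) else 0) v : Set ((UnitaryGroup.cmDatum L 3 (Matrix.of fun i j : Fin 3 => if i.val + j.val + 1 = 3 then (1 : L) else 0)).Local v)) :=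
  isLocSmooth_of_level_invariant_of_support_subset L 3 (Matrix.of fun i j : Fin 3 => if i.val + j.val + 1 = 3 then (1 : L) else 0) (IsCMField.complexConj_ne_one L) w hw hϖ0 n _
    (fun U hU x => indicator_profile_level_mul_eq L w hw prof hϖ0 hϖ1 hn hclass U hU x)
    ((Set.support_indicator_subset).trans fun _ hu => hu.1)

/-! ## §2  The three profile pieces of ★ №3 at the level `n := mstarFn L v w + 2` -/

omit [IsCMField L] in
/-- Bookkeeping at a uniformiser: `ϖ ≠ 0`, `|ϖ| < 1`, `|ϖ| ≤ 1`. [cite: Kottwitz1986BaseChangeUnits, §1 pp. 240–241] -/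
theorem uniformizer_facts {ϖ : w.1.adicCompletion L} (hϖ : Valued.v ϖ = WithZero.exp (-1 : ℤ)) :
    ϖ ≠ 0 ∧ Valued.v ϖ < 1 ∧ Valued.v ϖ ≤ 1 := by
  have h0 : ϖ ≠ 0 := fun h => by rw [h, map_zero] at hϖ; exact WithZero.coe_ne_zero hϖ.symm
  have h1 : Valued.v ϖ < 1 := by rw [hϖ, ← WithZero.exp_zero, WithZero.exp_lt_exp]; norm_num
  exact ⟨h0, h1, h1.le⟩

include hw in
/-- **`f_{T+}` IS `IsLocSmooth` WITH `tsupport ⊆ K`** (left-invariant under `ι U ≡ 1 (mod ϖ^{m*+2})`; U4-a clauses smooth∕support for `j = 1`). [cite: Rogawski1990, §1.6 p. 6]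
[cite: BernsteinZelevinsky1976, §1.1] -/
theorem isLocSmooth_pieceTransvPlus {ϖ : w.1.adicCompletion L} (hϖ : Valued.v ϖ = WithZero.exp (-1 : ℤ)) :
    IsLocSmooth (pieceTransvPlus L v w hw ϖ) ∧ tsupport (pieceTransvPlus L v w hw ϖ) ⊆ (cmLocalIntegralLevel L 3 (Matrix.of fun i j : Fin 3 => if i.val + j.val + 1 = 3 then (1 : L) else 0) v : Set ((UnitaryGroup.cmDatum L 3 (Matrix.of fun i j : Fin 3 => if i.val + j.val + 1 = 3 then (1 : L) else 0)).Local v)) := by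
  obtain ⟨hϖ0, hϖ1, hϖ1'⟩ := uniformizer_facts L w hϖ
  have hvσ : ∀ a : w.1.adicCompletion L, Valued.v ((galAdicCompletionMap (L := L) (IsCMField.complexConj L) hw) a) = Valued.v a := fun a => valued_galAdicCompletionMap (L := L) (IsCMField.complexConj L) hw a
  have hℓ : dOfPlace L v w % 2 + 1 ≤ mstarFn L v w + 2 := by have := Nat.mod_lt (dOfPlace L v w) (show 0 < 2 by norm_num); omega
  simp only [pieceTransvPlus, wMatrix]
  exact isLocSmooth_indicator_profile L w hw
    (fun X => NearTransvShell ϖ (dOfPlace L v w % 2) (mstarFn L v w) X ∧ LabelPlus (galAdicCompletionMap (L := L) (IsCMField.complexConj L) hw) ϖ (dOfPlace L v w) (mstarFn L v w) X)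
    hϖ0 hϖ1 (show 1 ≤ mstarFn L v w + 2 by omega)
    (fun X D hX hD => and_congr (nearTransvShell_add_iff hϖ0 hϖ1' hℓ (Nat.le_add_right _ 2) hX hD) (labelPlus_add_iff hvσ hϖ (Nat.le_add_right _ 2) _ X hD))

include hw in
/-- **`f_{T−}` IS `IsLocSmooth` WITH `tsupport ⊆ K`** (U4-a clauses smooth∕support for `j = 2`). [cite: Rogawski1990, §1.6 p. 6] [cite: BernsteinZelevinsky1976, §1.1] -/
theorem isLocSmooth_pieceTransvMinus {ϖ : w.1.adicCompletion L} (hϖ : Valued.v ϖ = WithZero.exp (-1 : ℤ)) :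
    IsLocSmooth (pieceTransvMinus L v w hw ϖ) ∧ tsupport (pieceTransvMinus L v w hw ϖ) ⊆ (cmLocalIntegralLevel L 3 (Matrix.of fun i j : Fin 3 => if i.val + j.val + 1 = 3 then (1 : L) else 0) v : Set ((UnitaryGroup.cmDatum L 3 (Matrix.of fun i j : Fin 3 => if i.val + j.val + 1 = 3 then (1 : L) else 0)).Local v)) := by
  obtain ⟨hϖ0, hϖ1, hϖ1'⟩ := uniformizer_facts L w hϖ
  have hvσ : ∀ a : w.1.adicCompletion L, Valued.v ((galAdicCompletionMap (L := L) (IsCMField.complexConj L) hw) a) = Valued.v a := fun a => valued_galAdicCompletionMap (L := L) (IsCMField.complexConj L) hw a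
  have hℓ : dOfPlace L v w % 2 + 1 ≤ mstarFn L v w + 2 := by have := Nat.mod_lt (dOfPlace L v w) (show 0 < 2 by norm_num); omega
  simp only [pieceTransvMinus, wMatrix]
  exact isLocSmooth_indicator_profile L w hw
    (fun X => NearTransvShell ϖ (dOfPlace L v w % 2) (mstarFn L v w) X ∧ ¬ LabelPlus (galAdicCompletionMap (L := L) (IsCMField.complexConj L) hw) ϖ (dOfPlace L v w) (mstarFn L v w) X)
    hϖ0 hϖ1 (show 1 ≤ mstarFn L v w + 2 by omega)
    (fun X D hX hD => and_congr (nearTransvShell_add_iff hϖ0 hϖ1' hℓ (Nat.le_add_right _ 2) hX hD)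
      (not_congr (labelPlus_add_iff hvσ hϖ (Nat.le_add_right _ 2) _ X hD)))

include hw in
/-- **`f_reg` IS `IsLocSmooth` WITH `tsupport ⊆ K`** (U4-a clauses smooth∕support for `j = 3`). [cite: Rogawski1990, §1.6 p. 6] [cite: BernsteinZelevinsky1976, §1.1] -/
theorem isLocSmooth_pieceReg {ϖ : w.1.adicCompletion L} (hϖ : Valued.v ϖ = WithZero.exp (-1 : ℤ)) :
    IsLocSmooth (pieceReg L v w hw ϖ) ∧ tsupport (pieceReg L v w hw ϖ) ⊆ (cmLocalIntegralLevel L 3 (Matrix.of fun i j : Fin 3 => if i.val + j.val + 1 = 3 then (1 : L) else 0) v : Set ((UnitaryGroup.cmDatum L 3 (Matrix.of fun i j : Fin 3 => if i.val + j.val + 1 = 3 then (1 : L) else 0)).Local v)) := by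
  obtain ⟨hϖ0, hϖ1, hϖ1'⟩ := uniformizer_facts L w hϖ
  simp only [pieceReg, wMatrix]
  exact isLocSmooth_indicator_profile L w hw (fun X => ¬ InLevel ϖ (mstarFn L v w) (X * X)) hϖ0 hϖ1 (show 1 ≤ mstarFn L v w + 2 by omega)
    (fun X D hX hD => not_congr (inLevel_mul_self_add_iff hϖ0 hϖ1' (Nat.le_add_right _ 2) hX hD))

include hw in
/-- **THE THREE PROFILE PIECES ARE `Ad K`-INVARIANT** (U4-a clause `Ad K` for `j = 1, 2, 3`). [cite: Kottwitz1986BaseChangeUnits, §3] [cite: Rogawski1990, §4.9 p. 54] -/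
theorem pieces_conj_eq {ϖ : w.1.adicCompletion L} (hϖ : Valued.v ϖ = WithZero.exp (-1 : ℤ)) {k : ((UnitaryGroup.cmDatum L 3 (Matrix.of fun i j : Fin 3 => if i.val + j.val + 1 = 3 then (1 : L) else 0)).Local v)} (hk : k ∈ cmLocalIntegralLevel L 3 (Matrix.of fun i j : Fin 3 => if i.val + j.val + 1 = 3 then (1 : L) else 0) v) (x : ((UnitaryGroup.cmDatum L 3 (Matrix.of fun i j : Fin 3 => if i.val + j.val + 1 = 3 then (1 : L) else 0)).Local v)) :
    pieceTransvPlus L v w hw ϖ (k * x * k⁻¹) = pieceTransvPlus L v w hw ϖ x ∧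
      pieceTransvMinus L v w hw ϖ (k * x * k⁻¹) = pieceTransvMinus L v w hw ϖ x ∧ pieceReg L v w hw ϖ (k * x * k⁻¹) = pieceReg L v w hw ϖ x := by
  obtain ⟨hϖ0, -, -⟩ := uniformizer_facts L w hϖ
  refine ⟨?_, ?_, ?_⟩
  · simp only [pieceTransvPlus, wMatrix]
    exact indicator_profile_conj_eq L w hw
      (fun X => NearTransvShell ϖ (dOfPlace L v w % 2) (mstarFn L v w) X ∧ LabelPlus (galAdicCompletionMap (L := L) (IsCMField.complexConj L) hw) ϖ (dOfPlace L v w) (mstarFn L v w) X)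
      (fun g hgU hgL X => and_congr (nearTransvShell_units_conj_iff hϖ0 _ _ X hgL) (labelPlus_units_conj_iff _ ϖ _ _ X hgU hgL)) hk x
  · simp only [pieceTransvMinus, wMatrix]
    exact indicator_profile_conj_eq L w hw
      (fun X => NearTransvShell ϖ (dOfPlace L v w % 2) (mstarFn L v w) X ∧ ¬ LabelPlus (galAdicCompletionMap (L := L) (IsCMField.complexConj L) hw) ϖ (dOfPlace L v w) (mstarFn L v w) X)
      (fun g hgU hgL X => and_congr (nearTransvShell_units_conj_iff hϖ0 _ _ X hgL) (not_congr (labelPlus_units_conj_iff _ ϖ _ _ X hgU hgL))) hk x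
  · simp only [pieceReg, wMatrix]
    refine indicator_profile_conj_eq L w hw (fun X => ¬ InLevel ϖ (mstarFn L v w) (X * X)) (fun g _hgU hgL X => not_congr ?_) hk x
    have hsq : (g : Matrix (Fin 3) (Fin 3) (w.1.adicCompletion L))⁻¹ * X * (g : Matrix (Fin 3) (Fin 3) (w.1.adicCompletion L)) *
        ((g : Matrix (Fin 3) (Fin 3) (w.1.adicCompletion L))⁻¹ * X * (g : Matrix (Fin 3) (Fin 3) (w.1.adicCompletion L))) =
        (g : Matrix (Fin 3) (Fin 3) (w.1.adicCompletion L))⁻¹ * (X * X) * (g : Matrix (Fin 3) (Fin 3) (w.1.adicCompletion L)) := by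
      rw [Matrix.mul_assoc ((g : Matrix (Fin 3) (Fin 3) (w.1.adicCompletion L))⁻¹) X (g : Matrix (Fin 3) (Fin 3) (w.1.adicCompletion L)), conj_mul_conj g X X]
      simp only [Matrix.mul_assoc]
    rw [hsq, inLevel_units_conj_iff hϖ0 _ _ hgL]

end Summit.HodgeConjecture.HodgeConjecture.Cruxes.H413.F0P3cDyRamProfilePiecesProps

end
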